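import Literature.NumberTheory.EllipticCurves.NeronModelGroupStructure
import Literature.NumberTheory.DiophantineGeometry.AbelianVarietyOrdinaryReduction
import Literature.AlgebraicGeometry.Limits.SurjectiveOfGenericFibre
import Literature.AlgebraicGeometry.Limits.RelativeDimensionDescent
import Literature.AlgebraicGeometry.Motives.AbelianVarietyProofs
import HarnessLib

/-!
# A Néron model of a variety with good reduction is an abelian-scheme model

Topic `Literature/NumberTheory/EllipticCurves` (Néron models, BLR §1.2); namespace
`Literature.NumberTheory.EllipticCurves`.  KERNEL ONLY: theorems; no definition, no named fact,
no `sorry`.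

Setting: `R` a Dedekind domain with fraction field `K`, `N` a Néron model over `R` (group-free sense
`IsSchematicNeronModel`, or `IsNeronModel`) of a `K`-scheme `E`, and `𝒳` a smooth proper
`R`-scheme with generic fibre `𝒳_K ≅ E` (a *smooth proper model*, no group structure asked for).

* `denseRange_pullback_fst_of_flat` — the generic fibre of a flat `X → S` (`S` irreducible) is
  dense in `X` (generisations lift along flat maps, EGA IV₂ 2.3.4).
* `IsSchematicNeronModel.surjective_left_of_isProper` — an `R`-morphism `φ : 𝒳 → N` from a proper
  `R`-scheme which is an isomorphism on generic fibres is surjective (its image is closed and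
  contains the dense generic fibre).
* `IsSchematicNeronModel.isProper_of_isProper_of_smooth` — **BLR 1.2/8**: if `E` has a smooth
  proper model `𝒳` over `R`, then the Néron model `N` of `E` is proper over `R`: the mapping
  property extends `𝒳_K ≅ E ≅ N_K` to `φ : 𝒳 → N`, `φ` is surjective, so `N` is universally
  closed (BLR, *Néron Models*, Prop. 1.2/8: "Let `X` be a smooth proper `R`-model of `X_K` … then
  `X` is a Néron model"; with uniqueness of Néron models this says the Néron model is proper —
  we prove the properness directly, without invoking uniqueness).
* `smoothOfRelativeDimension_of_iso_genericFibre` — a smooth `R`-scheme whose generic fibre is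
  smooth of relative dimension `n` is smooth of relative dimension `n` (relative dimension is
  locally constant and the generic fibre is dense).
* `IsNeronModel.isAbelianSchemeModel`, `IsSchematicNeronModel.exists_isAbelianSchemeModel` — for
  an abelian variety `A` over a number field `K` with good reduction at `v`
  (`HasGoodReductionAt A.X A.dim v`: SOME smooth proper model, Serre–Tate §1), a Néron model of
  `A` at `v` is an abelian-scheme model of `A` at `v` (`IsAbelianSchemeModel`: smooth of relative
  dimension `dim A`, proper, generic fibre `≅ A` as group schemes).
* `exists_isAbelianSchemeModel_of_hasGoodReductionAt_of_exists_isNeronModel` — hence the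
  existence of Néron models over `𝓞_{K,v}` (the tree's named fact `exists_isNeronModel`,
  BLR 1.3/2) turns good reduction in the sense of `HasGoodReductionAt` into the existence of an
  abelian-scheme model (good reduction in the sense of Serre–Tate: `A` is the generic fibre of an
  abelian scheme over `𝓞_{K,v}`).

## References
* [BLRNeronModels1990] S. Bosch, W. Lütkebohmert, M. Raynaud, *Néron Models*, Springer 1990,
  §1.2, Prop. 8; §1.3, Cor. 2.
* [SerreTate1968] J.-P. Serre, J. Tate, *Good reduction of abelian varieties*, Ann. of Math. 88
  (1968), §1.
* [EGAIV2] A. Grothendieck, J. Dieudonné, EGA IV₂, Prop. 2.3.4.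
-/

set_option autoImplicit false

noncomputable section

universe u

open CategoryTheory CategoryTheory.Limits AlgebraicGeometry Topology

namespace Literature.NumberTheory.EllipticCurves

/-! ### The generic fibre of a flat scheme over an irreducible base is dense -/

/-- If `f : X ⟶ S` is flat, `S` is irreducible and `i : S' ⟶ S` hits the generic point of `S`
(e.g. `i = Spec K → Spec R` for a domain `R` with fraction field `K`), then the base change
`X ×_S S' ⟶ X` has dense image: every point of `X` is a specialisation of a point over the generic
point, because generisations lift along flat morphisms. [cite: EGAIV2, Prop. 2.3.4] -/
theorem denseRange_pullback_fst_of_flat {X S S' : Scheme.{u}} (f : X ⟶ S) (i : S' ⟶ S) [Flat f]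
    [IrreducibleSpace S] (hi : genericPoint S ∈ Set.range i) :
    DenseRange (pullback.fst f i) := by
  intro x
  obtain ⟨x', hx'x, hfx'⟩ :=
    Flat.generalizingMap f (a := x) (b := genericPoint S) (genericPoint_specializes (f x))
  have hx' : x' ∈ Set.range (pullback.fst f i) := by
    rw [Scheme.Pullback.range_fst]
    show f x' ∈ Set.range i
    rwa [hfx']
  exact closure_mono (Set.singleton_subset_iff.2 hx') (specializes_iff_mem_closure.1 hx'x)

section General

variable {R : Type u} [CommRing R] [IsDedekindDomain R] {K : Type u} [Field K] [Algebra R K]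
  [IsFractionRing R K]

/-- For a Néron model `N` over `R` (group-free sense) and a PROPER `R`-scheme `𝒳`, an `R`-morphism
`φ : 𝒳 → N` inducing an isomorphism of generic fibres is surjective: `φ` is universally closed
(`𝒳` proper, `N` separated), so its image is closed, and it contains the generic fibre `N_K`,
which is dense in the flat `R`-scheme `N`. [cite: BLRNeronModels1990, §1.2, Prop. 8] -/
theorem IsSchematicNeronModel.surjective_left_of_isProper {N 𝒳 : Over (Spec (.of R))}
    {E : Over (Spec (.of K))} (hN : IsSchematicNeronModel R K N E) (h𝒳 : IsProper 𝒳.hom)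
    (φ : 𝒳 ⟶ N) [IsIso ((genericFibre R K).map φ)] : Surjective φ.left := by
  haveI := hN.smooth
  haveI := hN.isSeparated
  haveI : IrreducibleSpace ↥(Spec (.of R)) := PrimeSpectrum.irreducibleSpace
  haveI : UniversallyClosed (φ.left ≫ N.hom) := by rw [Over.w φ]; infer_instance
  haveI : UniversallyClosed φ.left := .of_comp_of_isSeparated _ N.hom
  haveI : IsIso ((genericFibre R K).map φ).left :=
    inferInstanceAs (IsIso ((Over.forget _).map ((genericFibre R K).map φ)))
  -- the instance must be keyed on `pullback _ _`, the source/target of `pullback.fst`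
  haveI : @Surjective (pullback 𝒳.hom (specGenericPoint R K))
      (pullback N.hom (specGenericPoint R K)) ((genericFibre R K).map φ).left :=
    (inferInstance : Surjective ((genericFibre R K).map φ).left)
  refine Literature.AlgebraicGeometry.Limits.surjective_of_surjective_of_comm_sq φ.left N.hom
    (pullback.fst 𝒳.hom (specGenericPoint R K)) (pullback.fst N.hom (specGenericPoint R K))
    ((genericFibre R K).map φ).left ?_ fun y hy => ?_
  · exact (pullback.lift_fst _ _ _).symm
  · rw [Scheme.Pullback.range_fst]
    show N.hom y ∈ Set.range (specGenericPoint R K)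
    rw [hy]
    exact Literature.AlgebraicGeometry.Limits.genericPoint_mem_range_SpecMap (algebraMap R K)
      (IsFractionRing.injective R K)

/-- **A Néron model of a scheme with a smooth proper model is proper** (Bosch–Lütkebohmert–Raynaud,
*Néron Models*, Prop. 1.2/8). Let `N` be a Néron model over `R` of the `K`-scheme `E` (group-free
sense: smooth, separated, of finite type, `N_K ≅ E`, Néron mapping property) and let `𝒳` be a
smooth proper `R`-scheme with `𝒳_K ≅ E`. Then `N → Spec R` is proper: the Néron mapping property
extends `𝒳_K ≅ E ≅ N_K` to an `R`-morphism `φ : 𝒳 → N`, which is surjective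
(`surjective_left_of_isProper`), so `N` is universally closed since `𝒳` is.
[cite: BLRNeronModels1990, §1.2, Prop. 8] -/
theorem IsSchematicNeronModel.isProper_of_isProper_of_smooth {N : Over (Spec (.of R))}
    {E : Over (Spec (.of K))} (hN : IsSchematicNeronModel R K N E) (𝒳 : Over (Spec (.of R)))
    (h𝒳s : Smooth 𝒳.hom) (h𝒳p : IsProper 𝒳.hom) (e : (genericFibre R K).obj 𝒳 ≅ E) :
    IsProper N.hom := by
  obtain ⟨eN⟩ := hN.nonempty_iso
  obtain ⟨φ, hφ⟩ := (hN.mappingProperty 𝒳 h𝒳s).2 (e ≪≫ eN.symm).hom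
  have hφ' : (genericFibre R K).map φ = (e ≪≫ eN.symm).hom := hφ
  haveI : IsIso ((genericFibre R K).map φ) := by rw [hφ']; infer_instance
  haveI := hN.surjective_left_of_isProper h𝒳p φ
  haveI : UniversallyClosed (φ.left ≫ N.hom) := by rw [Over.w φ]; infer_instance
  haveI : UniversallyClosed N.hom := .of_comp_surjective φ.left N.hom
  haveI := hN.isSeparated
  haveI := hN.locallyOfFiniteType
  exact (isProper_iff _).2 ⟨‹_›, ‹_›, ‹_›⟩

/-- **Relative dimension is read off on the generic fibre.** If `N → Spec R` is smooth and its
generic fibre `N_K ≅ E` with `E → Spec K` smooth of relative dimension `n`, then `N → Spec R` is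
smooth of relative dimension `n`: the relative dimension of a smooth morphism is locally constant
on the source, and the generic fibre is dense in the flat `R`-scheme `N`
(`denseRange_pullback_fst_of_flat`), so every local relative dimension equals `n`
(Hartshorne III.10.1 (b); EGA IV₄ 17.10.2). [cite: EGAIV2, Prop. 2.3.4] -/
theorem smoothOfRelativeDimension_of_iso_genericFibre (N : Over (Spec (.of R))) (hNs : Smooth N.hom)
    (n : ℕ) {E : Over (Spec (.of K))} (e : (genericFibre R K).obj N ≅ E)
    (hE : SmoothOfRelativeDimension n E.hom) : SmoothOfRelativeDimension n N.hom := by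
  haveI := hNs
  haveI : IrreducibleSpace ↥(Spec (.of R)) := PrimeSpectrum.irreducibleSpace
  haveI : SmoothOfRelativeDimension n (pullback.snd N.hom (specGenericPoint R K)) := by
    have h : SmoothOfRelativeDimension n (e.hom.left ≫ E.hom) :=
      (MorphismProperty.cancel_left_of_respectsIso (@SmoothOfRelativeDimension n) _ _).2 hE
    rwa [Over.w e.hom] at h
  exact Literature.AlgebraicGeometry.Limits.smoothOfRelativeDimension_of_isPullback_of_denseRange
    (IsPullback.of_hasPullback N.hom (specGenericPoint R K)) n
    (denseRange_pullback_fst_of_flat N.hom _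
      (Literature.AlgebraicGeometry.Limits.genericPoint_mem_range_SpecMap (algebraMap R K)
        (IsFractionRing.injective R K)))

end General

/-! ### Abelian varieties over number fields: Néron models at places of good reduction -/

section NumberField

open NumberField IsDedekindDomain IsDedekindDomain.HeightOneSpectrum
open Literature.AlgebraicGeometry.Motives Literature.NumberTheory.DiophantineGeometry

variable {K : Type} [Field K] [NumberField K] (A : AbelianVariety K) (v : HeightOneSpectrum (𝓞 K))

/-- **A Néron model at a place of good reduction is an abelian-scheme model.** Let `A` be an
abelian variety over a number field `K` with good reduction at the finite place `v` in the sense of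
`HasGoodReductionAt A.X A.dim v` (Serre–Tate §1: `A` has SOME smooth proper model over
`𝓞_{K,v}`, no group structure asked for), and let `N` be a Néron model of `A` over `𝓞_{K,v}`
(`IsNeronModel`, with its group structure). Then `N` is an abelian-scheme model of `A` at `v`
(`IsAbelianSchemeModel`): it is proper (`IsSchematicNeronModel.isProper_of_isProper_of_smooth`,
BLR 1.2/8), smooth of relative dimension `dim A` (read off on the generic fibre `N_K ≅ A`,
`smoothOfRelativeDimension_of_iso_genericFibre`), and `N_K ≅ A` as group schemes.
[cite: BLRNeronModels1990, §1.2, Prop. 8] [cite: SerreTate1968, §1] -/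
theorem IsNeronModel.isAbelianSchemeModel {N : SchemeOver (valuationSubringAtPrime K v)} [GrpObj N]
    (hN : IsNeronModel (valuationSubringAtPrime K v) K N A.X)
    (hA : HasGoodReductionAt A.X A.dim v) : IsAbelianSchemeModel A v N := by
  obtain ⟨𝒳, h𝒳s, h𝒳p⟩ := hA
  haveI := h𝒳s
  haveI : Smooth 𝒳.total.hom := SmoothOfRelativeDimension.smooth A.dim _
  obtain ⟨e, he⟩ := hN.exists_iso
  exact
    { smooth := smoothOfRelativeDimension_of_iso_genericFibre N hN.smooth A.dim e
        A.smoothOfRelativeDimension_dim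
      isProper := hN.isSchematicNeronModel.isProper_of_isProper_of_smooth 𝒳.total inferInstance
        h𝒳p 𝒳.genericIso
      exists_iso := ⟨e, he⟩ }

/-- The group-free form: if `N` is a Néron model of (the `K`-scheme underlying) `A` over
`𝓞_{K,v}` in the sense of `IsSchematicNeronModel` and `A` has good reduction at `v`, then `N`
carries a group-scheme structure (BLR 1.2/6, `IsSchematicNeronModel.exists_grp`) for which it is
an abelian-scheme model of `A` at `v`. [cite: BLRNeronModels1990, §1.2, Prop. 6 and Prop. 8] -/
theorem IsSchematicNeronModel.exists_isAbelianSchemeModel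
    {N : SchemeOver (valuationSubringAtPrime K v)}
    (hN : IsSchematicNeronModel (valuationSubringAtPrime K v) K N A.X)
    (hA : HasGoodReductionAt A.X A.dim v) : ∃ _ : GrpObj N, IsAbelianSchemeModel A v N := by
  obtain ⟨𝒢, h𝒢, h⟩ := hN.exists_grp
  subst h𝒢
  exact ⟨inferInstance, h.isAbelianSchemeModel A v hA⟩

/-- **Good reduction (smooth proper model) ⇒ good reduction (abelian-scheme model), granted the
existence of Néron models.** If every abelian variety over `K` has a Néron model over `𝓞_{K,v}`
(the tree's named fact `exists_isNeronModel 𝓞_{K,v} K`: Néron 1964; BLR Cor. 1.3/2) and the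
abelian variety `A / K` has good reduction at `v` in the sense of `HasGoodReductionAt A.X A.dim v`
(a smooth proper model over `𝓞_{K,v}`, Serre–Tate §1), then `A` has an abelian-scheme model at
`v` (`IsAbelianSchemeModel`): its Néron model. [cite: BLRNeronModels1990, §1.2, Prop. 8; §1.3, Cor. 2]
[cite: SerreTate1968, §1] -/
theorem exists_isAbelianSchemeModel_of_hasGoodReductionAt_of_exists_isNeronModel
    (hNer : exists_isNeronModel (valuationSubringAtPrime K v) K)
    (hA : HasGoodReductionAt A.X A.dim v) :
    ∃ (𝒜 : SchemeOver (valuationSubringAtPrime K v)) (_ : GrpObj 𝒜), IsAbelianSchemeModel A v 𝒜 := by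
  obtain ⟨𝒩, h𝒩⟩ := hNer A.X
  exact ⟨𝒩.X, inferInstance, h𝒩.isAbelianSchemeModel A v hA⟩

end NumberField

end Literature.NumberTheory.EllipticCurves

end
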